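import Mathlib.Algebra.Polynomial.HasseDeriv
import Mathlib.Algebra.Polynomial.Taylor
import Mathlib.Algebra.Polynomial.Degree.Domain
import Mathlib.Algebra.Polynomial.Expand
import Mathlib.FieldTheory.Perfect
import HarnessLib

/-!
# The Hasse kernel lemma (equal-weight tail-kernel lemma) and the axis-cage divisibility lemma

[OURS · L1 W4.3 · door `HypersurfaceCentreConstruction` (stmt-ResolutionOfSingularities-19897), crux `WeightedConstruction`
(stmt-ResolutionOfSingularities-0571) · res-L1-w43-idea-2 ROUND 8, card R8-A `frobenius-part-kernel`; OFFER (o57) widened by res-L1-w43-plan-1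
2026-08-27T15:32:19Z: «landable verbatim as `Theorems/WeightedInvariantHasseKernelLemma.lean --supports 19897 --as helper`».  DEF-FREE,
Mathlib-only.  Not a statement of [Hironaka2017]; folklore algebra (Taylor expansion + perfectness).]

* `hasse_kernel_lemma` — over a PERFECT field `k` of characteristic `p`, a polynomial `H` with `natDegree H ≤ D` all of whose Hasse
  derivatives `(hasseDeriv l H).eval c` vanish for `l < D`, `p ∤ l`, is `C a * (X - C c) ^ D + G ^ p`.  Dictionary (IDEAS R8-A (W3)): at an
  equal-weight wild tie orbit `z = c·y` of `x^p + y^D·H(z/y)` the non-Frobenius part of the successor below order `D` is the list of these Hasse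
  values, so «no ratio drop» forces `h = a(z − cy)^D + (p-th power)` — absorbed or quasi-homogeneous.
* `dvd_of_pow_eq_C_mul_X_pow` — `g ^ p = C c * X ^ a`, `c ≠ 0` ⇒ `p ∣ a` (the one-line reason no monomial restricted to a coordinate-axis tie orbit
  is a `p`-th power over `k(μ)` unless it was one over `k`: the R7 «cage»).
-/

open Polynomial

set_option linter.dupNamespace false -- mandated namespace of this single-conjunct summit

namespace Summit.ResolutionOfSingularities.ResolutionOfSingularities.Theorems

namespace Iota3.HasseKernel

variable {k : Type} [Field k]

/-- **Axis cage.** If `g ^ p = c · X ^ a` with `c ≠ 0` in `k[X]` (`k` a field), then `p ∣ a`. [folklore] -/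
theorem dvd_of_pow_eq_C_mul_X_pow {p a : ℕ} {c : k} (hc : c ≠ 0) {g : k[X]}
    (h : g ^ p = C c * X ^ a) : p ∣ a := by
  have hdeg : (g ^ p).natDegree = a := by rw [h, natDegree_C_mul_X_pow a c hc]
  rw [natDegree_pow] at hdeg
  exact ⟨g.natDegree, hdeg.symm⟩

/-- **(W3) in the no-tail / equal-weight case — the Hasse kernel lemma (PROVED).**  Over a PERFECT field of characteristic `p`, a
polynomial `H` of degree `≤ D` all of whose Hasse derivatives `H^{[l]}(c)` vanish for `l < D` with `p ∤ l` is
`a·(X − c)^D + G^p` for some `a : k`, `G : k[X]`.  (Taylor expansion at `c`: only the exponents `l` with `p ∣ l`, and possibly `l = D`,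
survive; a polynomial in `(X − c)^p` with coefficients in `k = k^p` is a `p`-th power.)  Dictionary: at an equal-weight (wild, `p ∣ g`)
tie orbit `z = c·y` of `x^p + y^{D}H(z/y)`, the successor's non-Frobenius part below order `D = d/w` is exactly the list of these Hasse
values, so "no ratio drop" forces `h = a(z − cy)^D + (p-th power)` — absorbed or quasi-homogeneous in `(x′, z − cy, y)`. [folklore] -/
theorem hasse_kernel_lemma (p : ℕ) [Fact p.Prime] [CharP k p] [PerfectField k]
    (H : k[X]) (c : k) (D : ℕ) (hdeg : H.natDegree ≤ D)
    (hvan : ∀ l < D, ¬ p ∣ l → (hasseDeriv l H).eval c = 0) :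
    ∃ (a : k) (G : k[X]), H = C a * (X - C c) ^ D + G ^ p := by
  classical
  have hcoeff : ∀ l, (taylor c H).coeff l = (hasseDeriv l H).eval c := fun l => taylor_coeff c H l
  have hTdeg : (taylor c H).natDegree ≤ D := (natDegree_taylor H c).le.trans hdeg
  -- Taylor's formula as a finite sum over `range (D + 1)`
  have hT : H = ∑ l ∈ Finset.range (D + 1), C ((taylor c H).coeff l) * (X - C c) ^ l := by
    conv_lhs => rw [← sum_taylor_eq H c]
    rw [Polynomial.sum_def]
    refine Finset.sum_subset (fun l hl => Finset.mem_range.mpr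
      (Nat.lt_succ_of_le ((le_natDegree_of_mem_supp l hl).trans hTdeg))) (fun l _ hl => ?_)
    have h0 : (taylor c H).coeff l = 0 := by simpa [mem_support_iff] using hl
    simp [h0]
  have hzero : ∀ l ∈ Finset.range D, ¬ p ∣ l → (taylor c H).coeff l = 0 := fun l hl hpl => by
    rw [hcoeff]; exact hvan l (Finset.mem_range.mp hl) hpl
  -- `p`-th roots of the surviving terms (perfectness of `k`)
  have key : ∀ l ∈ (Finset.range D).filter (fun l => p ∣ l),
      ∃ Q : k[X], Q ^ p = C ((taylor c H).coeff l) * (X - C c) ^ l := by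
    intro l hl
    obtain ⟨m, hm⟩ := (Finset.mem_filter.mp hl).2
    refine ⟨C ((frobeniusEquiv k p).symm ((taylor c H).coeff l)) * (X - C c) ^ m, ?_⟩
    rw [mul_pow, ← C_pow, frobeniusEquiv_symm_pow_p, ← pow_mul, mul_comm m p, ← hm]
  choose Q hQ using key
  refine ⟨(taylor c H).coeff D, ∑ l ∈ ((Finset.range D).filter (fun l => p ∣ l)).attach, Q l.1 l.2, ?_⟩
  have hrest : ∑ l ∈ (Finset.range D).filter (fun l => ¬ p ∣ l), C ((taylor c H).coeff l) * (X - C c) ^ l = 0 :=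
    Finset.sum_eq_zero fun l hl => by
      obtain ⟨hl1, hl2⟩ := Finset.mem_filter.mp hl
      simp [hzero l hl1 hl2]
  have hpow : (∑ l ∈ ((Finset.range D).filter (fun l => p ∣ l)).attach, Q l.1 l.2) ^ p
      = ∑ l ∈ (Finset.range D).filter (fun l => p ∣ l), C ((taylor c H).coeff l) * (X - C c) ^ l := by
    rw [sum_pow_char p, ← Finset.sum_attach ((Finset.range D).filter (fun l => p ∣ l))]
    exact Finset.sum_congr rfl fun l _ => hQ l.1 l.2
  calc H = ∑ l ∈ Finset.range (D + 1), C ((taylor c H).coeff l) * (X - C c) ^ l := hT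
    _ = C ((taylor c H).coeff D) * (X - C c) ^ D
          + ∑ l ∈ Finset.range D, C ((taylor c H).coeff l) * (X - C c) ^ l := by
        rw [Finset.sum_range_succ, add_comm]
    _ = C ((taylor c H).coeff D) * (X - C c) ^ D
          + ∑ l ∈ (Finset.range D).filter (fun l => p ∣ l), C ((taylor c H).coeff l) * (X - C c) ^ l := by
        rw [← Finset.sum_filter_add_sum_filter_not (Finset.range D) (fun l => p ∣ l), hrest, add_zero]
    _ = _ := by rw [hpow]

end Iota3.HasseKernel

end Summit.ResolutionOfSingularities.ResolutionOfSingularities.Theorems
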